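import Summits.NavierStokesRegularity.NavierStokesRegularity.Theorems.FilamentSkeletonRssSkeletonJ1RDefectTools
import Summits.NavierStokesRegularity.NavierStokesRegularity.Theorems.FilamentSkeletonRssSkeletonJ1RLiaReference
import Summits.NavierStokesRegularity.NavierStokesRegularity.Theorems.FilamentSkeletonRssSkeletonJ1RLiaGeometry
import Literature.Analysis.FluidPDE.BiotSavartCurlPair

/-!
# Route `FilamentSkeletonRss` · crux `SkeletonJ1R` (stmt-NavierStokesRegularity-23610) · stub F2 `LiaDefectL` — ASSEMBLY BRICK (A1):
# the switched defect of the LIA reference SPLITS into the self-strand local-induction error plus the partners' ambient-vs-actual mismatches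

Lead `ns-fsr-lead-23610` (g2), line `streamline_kantorovich_R` (skeleton of record v5).  Helper file `--supports stmt-NavierStokesRegularity-23610`;
route-independent (no `Theses` import).

`IsLiaReference.norm_swDefect_le`: for THE local-induction reference `x` (`IsLiaReference`: `x_j″ = β_j⁻¹ φ(x_j) • x_j′ × W_j(x_j)`) and a datum-sliced
model `M` (`SlicedModel Γ ρ 1 t x M`, tangent to the reference: `M(x_j τ) = (7/4)τ • x_j′ τ`), at every parameter:
`‖swDefect(x) j τ‖ ≤ ‖c_j • S_j(τ) − β_j • x_j′τ × x_j″τ‖ + Σ_{k≠j} ‖c_k • (S_k[x_k](x_j τ) − S_k[L_k](x_j τ))‖`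
(`c_k = Γγ_k/4π`, `S_k[Z](y) = ∫ K(‖y − Zσ‖) • Z′σ × (y − Zσ) dσ` the regularised Biot–Savart strand, `L_k` the datum line).  WHY: off the switched
region the defect vanishes (landed `swDefect_ref_eq_zero_of_switchWeight_eq_zero`); on it the cutoff is `1` (`refCutoff_eq_one_of_switchWeight_pos`),
so `x′ × W = β x″` and the component of `W` normal to `x′` is `−β x′ × x″` (BAC−CAB); the model is tangent, the switch weight is in `[0,1]`, and
`trueField = c_j S_j + Σ_{k≠j} c_k (S_k[x_k] − S_k[L_k]) + W_j` by the definitions of `bsField` / `ambientField`.  The two summands are bounded by the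
self-strand brick S4 (`IsLiaReference.selfStrand_sub_lia_le`) and the partner brick P2 (`IsLiaReference.partnerStrand_sub_le`).
HONEST FRAMING: MODEL rung, ∃-side helper lemmas toward stub F2 of a HYPOTHETICAL filament-type blow-up skeleton; F2 and the crux 23610 stay OPEN;
nothing here bears on Navier–Stokes regularity, which is NOT proved. [folklore]
-/

-- `dupNamespace` off: the module name repeats `NavierStokesRegularity` by the tree's `Summits/<S>/<S>/Theorems` layout (same as every sibling file).
set_option linter.dupNamespace false

noncomputable section

namespace Summit.NavierStokesRegularity.NavierStokesRegularity.Theorems.SkeletonJ1RFrame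

open Set Function Filter Real Topology MeasureTheory
open Literature.Analysis.FluidPDE
open Summit.NavierStokesRegularity.NavierStokesRegularity.Theorems.SkeletonJ1RDefectTools (swDefect_ref_eq_zero_of_switchWeight_eq_zero)
open scoped InnerProductSpace BigOperators

variable {N : ℕ} {Γ Rb ρ : ℝ} {p t : Fin N → EuclideanSpace ℝ (Fin 3)} {γ : Fin N → ℝ} {α : ℝ} {s₀ : Fin N → ℝ}
  {x : Fin N → ℝ → EuclideanSpace ℝ (Fin 3)} {M : EuclideanSpace ℝ (Fin 3) → EuclideanSpace ℝ (Fin 3)}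

/-- `⟪T × v, T⟫ = 0`. [folklore] -/
theorem inner_cross_self_left (T v : EuclideanSpace ℝ (Fin 3)) : inner ℝ (cross T v) T = 0 := by
  simp only [cross, PiLp.inner_apply, RCLike.inner_apply, conj_trivial, Fin.sum_univ_three,
    cross_apply, Matrix.cons_val_zero, Matrix.cons_val_one, Matrix.cons_val_two,
    Matrix.head_cons, Matrix.tail_cons]
  ring

/-- The component of `W` normal to a unit vector `T`: `W − ⟪W, T⟫T = −T × (T × W)`. [folklore] -/
theorem perpTo_eq_neg_cross_cross (T W : EuclideanSpace ℝ (Fin 3)) (hT : ‖T‖ = 1) :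
    W - (inner ℝ W T) • T = -cross T (cross T W) := by
  rw [cross_cross_right, real_inner_self_eq_norm_sq, hT, one_pow, one_smul, real_inner_comm]
  abel

/-- **The defect splits** (see the module docstring). [folklore] -/
theorem IsLiaReference.norm_swDefect_le (hx : IsLiaReference Γ Rb p t γ α s₀ x) (hM : SlicedModel Γ ρ 1 t x M)
    (hρΓ : 0 ≤ ρ * Real.sqrt Γ) (hℓ : Rb * Real.sqrt (Γ * Real.log Γ) ≠ 0) (j : Fin N) (hβ : liaCoeff Γ γ j ≠ 0) (τ : ℝ) :
    ‖swDefect Γ Rb γ α M x j τ‖ ≤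
      ‖(Γ * γ j / (4 * Real.pi)) • (∫ σ : ℝ, ((‖x j τ - x j σ‖ ^ 2 +
          Real.exp (-(1+Real.eulerMascheroniConstant-Real.log 2)) * (1:ℝ)) ^ (3 / 2 : ℝ))⁻¹ • cross (deriv (x j) σ) (x j τ - x j σ)) -
        liaCoeff Γ γ j • cross (deriv (x j) τ) (deriv (deriv (x j)) τ)‖ +
      ∑ k ∈ Finset.univ.erase j, ‖(Γ * γ k / (4 * Real.pi)) • ((∫ σ : ℝ, ((‖x j τ - x k σ‖ ^ 2 +
          Real.exp (-(1+Real.eulerMascheroniConstant-Real.log 2)) * (1:ℝ)) ^ (3 / 2 : ℝ))⁻¹ • cross (deriv (x k) σ) (x j τ - x k σ)) -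
        ∫ σ : ℝ, ((‖x j τ - datumLine Γ p t s₀ k σ‖ ^ 2 +
          Real.exp (-(1+Real.eulerMascheroniConstant-Real.log 2)) * (1:ℝ)) ^ (3 / 2 : ℝ))⁻¹ • cross (t k) (x j τ - datumLine Γ p t s₀ k σ))‖ := by
  obtain ⟨hC2, hunit, h0, h0', hode⟩ := hx j
  set ℓ := Rb * Real.sqrt (Γ * Real.log Γ) with hℓdef
  set β := liaCoeff Γ γ j with hβdef
  set y := x j τ with hy
  set T := deriv (x j) τ with hT
  have hT1 : ‖T‖ = 1 := hunit τ
  -- strands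
  set A : Fin N → EuclideanSpace ℝ (Fin 3) := fun k => ∫ σ : ℝ, ((‖y - x k σ‖ ^ 2 +
      Real.exp (-(1+Real.eulerMascheroniConstant-Real.log 2)) * (1:ℝ)) ^ (3 / 2 : ℝ))⁻¹ • cross (deriv (x k) σ) (y - x k σ) with hA
  set B : Fin N → EuclideanSpace ℝ (Fin 3) := fun k => ∫ σ : ℝ, ((‖y - datumLine Γ p t s₀ k σ‖ ^ 2 +
      Real.exp (-(1+Real.eulerMascheroniConstant-Real.log 2)) * (1:ℝ)) ^ (3 / 2 : ℝ))⁻¹ • cross (t k) (y - datumLine Γ p t s₀ k σ) with hB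
  set c : Fin N → ℝ := fun k => Γ * γ k / (4 * Real.pi) with hc
  -- the right-hand side is nonnegative
  have hRHS : 0 ≤ ‖c j • A j - β • cross T (deriv (deriv (x j)) τ)‖ + ∑ k ∈ Finset.univ.erase j, ‖c k • (A k - B k)‖ :=
    add_nonneg (norm_nonneg _) (Finset.sum_nonneg fun k _ => norm_nonneg _)
  change ‖swDefect Γ Rb γ α M x j τ‖ ≤ ‖c j • A j - β • cross T (deriv (deriv (x j)) τ)‖ + ∑ k ∈ Finset.univ.erase j, ‖c k • (A k - B k)‖
  by_cases hw : switchWeight ℓ 1 y = 0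
  · rw [swDefect_ref_eq_zero_of_switchWeight_eq_zero hM hρΓ (fun k σ => (hx k).2.1 σ) j τ hw, norm_zero]
    exact hRHS
  -- on the switched region the cutoff is 1
  have hσpos : 0 < switchWeight ℓ 1 y := lt_of_le_of_ne (switchWeight_nonneg _ _ _) (Ne.symm hw)
  have hcut : refCutoff ℓ y = 1 := refCutoff_eq_one_of_switchWeight_pos hℓ le_rfl hσpos
  set W := ambientField Γ p t γ α s₀ j y with hW
  -- the LIA identity `T × W = β • x″`
  have hTW : cross T W = β • deriv (deriv (x j)) τ := by
    have h := hode τ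
    rw [iteratedDeriv_succ, iteratedDeriv_one] at h
    rw [← hy, ← hT] at h
    rw [hcut, mul_one, ← hW] at h
    rw [h, smul_smul, mul_inv_cancel₀ hβ, one_smul]
  have hPW : W - (inner ℝ W T) • T = -(β • cross T (deriv (deriv (x j)) τ)) := by
    rw [perpTo_eq_neg_cross_cross T W hT1, hTW, ← crossCLM_apply T, map_smul, crossCLM_apply]
  -- the true field in terms of the strands
  have htF : trueField Γ γ α x y = (c j • A j + ∑ k ∈ Finset.univ.erase j, c k • (A k - B k)) + W := by
    have hbs : bsField Γ γ x y = ∑ k, c k • A k := by unfold bsField; simp only [hc, hA]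
    have hamb : W = (∑ k ∈ Finset.univ.erase j, c k • B k) + (1/2:ℝ) • y - α • cross (EuclideanSpace.single 2 1) y := by
      rw [hW]; unfold ambientField; simp only [hc, hB]
    unfold trueField
    rw [hbs, hamb, ← Finset.add_sum_erase _ _ (Finset.mem_univ j)]
    simp only [smul_sub, Finset.sum_sub_distrib]
    abel
  -- the defect as the switch weight times the normal part of the true field
  set σw := switchWeight ℓ 1 y with hσw
  have hMy : M y = ((7/4:ℝ) * τ) • T := by rw [hy, hT]; exact hM.apply_ref hρΓ j τ
  have hdef : swDefect Γ Rb γ α M x j τ = σw • (trueField Γ γ α x y - (inner ℝ (trueField Γ γ α x y) T) • T) := by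
    unfold swDefect switchedField
    simp only [← hℓdef, ← hy, ← hT, ← hσw, hT1, one_pow, div_one]
    rw [hMy, perpTo_add, perpTo_smul, perpTo_smul, real_inner_smul_left, real_inner_self_eq_norm_sq, hT1, one_pow, mul_one,
      sub_self, smul_zero, add_zero]
  -- the normal part of the true field
  have hperp : trueField Γ γ α x y - (inner ℝ (trueField Γ γ α x y) T) • T =
      (c j • A j - β • cross T (deriv (deriv (x j)) τ) + ∑ k ∈ Finset.univ.erase j, c k • (A k - B k)) -
        (inner ℝ (c j • A j - β • cross T (deriv (deriv (x j)) τ) + ∑ k ∈ Finset.univ.erase j, c k • (A k - B k)) T) • T := by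
    rw [htF, perpTo_add, hPW]
    have horth : inner ℝ (β • cross T (deriv (deriv (x j)) τ)) T = 0 := by
      rw [real_inner_smul_left, inner_cross_self_left, mul_zero]
    simp only [inner_add_left, inner_sub_left, horth, sub_zero, add_smul]
    abel
  rw [hdef, norm_smul, Real.norm_eq_abs, abs_of_nonneg (switchWeight_nonneg _ _ _), hperp]
  calc σw * ‖(c j • A j - β • cross T (deriv (deriv (x j)) τ) + ∑ k ∈ Finset.univ.erase j, c k • (A k - B k)) -
        (inner ℝ (c j • A j - β • cross T (deriv (deriv (x j)) τ) + ∑ k ∈ Finset.univ.erase j, c k • (A k - B k)) T) • T‖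
      ≤ 1 * ‖(c j • A j - β • cross T (deriv (deriv (x j)) τ) + ∑ k ∈ Finset.univ.erase j, c k • (A k - B k))‖ :=
        mul_le_mul (switchWeight_le_one _ _ _) (norm_perpTo_le T _ hT1) (norm_nonneg _) zero_le_one
    _ ≤ ‖c j • A j - β • cross T (deriv (deriv (x j)) τ)‖ + ‖∑ k ∈ Finset.univ.erase j, c k • (A k - B k)‖ := by
        rw [one_mul]; exact norm_add_le _ _
    _ ≤ ‖c j • A j - β • cross T (deriv (deriv (x j)) τ)‖ + ∑ k ∈ Finset.univ.erase j, ‖c k • (A k - B k)‖ :=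
        add_le_add le_rfl (norm_sum_le _ _)

end Summit.NavierStokesRegularity.NavierStokesRegularity.Theorems.SkeletonJ1RFrame

end
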